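import Summits.ABC.ABC.Theorems.TwistAmplificationMazurKaneLawDEFibre
import Summits.ABC.ABC.Theorems.TwistAmplificationMazurKaneLawDECauchySchwarz
import Summits.ABC.ABC.Theorems.TwistAmplificationMazurKaneLawDELinEnergy
import Summits.ABC.ABC.Theorems.TwistAmplificationMazurKaneLawDEEnergySum

-- Summit.ABC.ABC is the mandated summit-side namespace (single-conjunct summit); the lakefile sets the same option tree-wide.
set_option linter.dupNamespace false

/-!
# The DE tool with host `X` (crux stmt-ABC-2757, stub `de_dispersionToolX`)

Assembly of the "DE tool" (dispersion = ratio Cauchy–Schwarz modulo the host modulus, followed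
by a multiplicative-energy count) for the line `critical-kloosterman-powerful-moduli` of the crux
`Summit.ABC.ABC.Theses.TwistAmplification.MazurKaneLaw`, with the `x`-term as host:
`Summit.ABC.ABC.Theorems.MazurKaneLaw.de_dispersionToolX` bounds the square of the shape count
`B = AbcShapes.shapeCount c₁ c₂ c₃ X Y Z` by
`4400 · Dτ^{6d+8} · Y₀Z₀ · max(1, Y₀Z₀/q₀) · NQ · (T₁ + T₂ + T₃ + T₄)`, where `q₀ = W_Q(X)`,
`NQ = #subBox Qᶜ X`, `Y₀ = Y_{i₀}`, `Z₀ = Z_{i₀}` and `T₁, …, T₄` are the four terms of the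
multiplicative-energy bound `de_energy_sum_le`.

The proof chains four landed lemmas:

* `de_shapeCount_le_fibre`: `B ≤ Dτ^d · #F`, `F` the set of `(r, y, z)`, `r ∈ subBox Qᶜ X` a host
  tuple, `(y, z)` in the side boxes, with `c₂V(y)`, `c₃V(z)` coprime to `q(r) = W_Q(r)` and
  `q(r) ∣ c₃V(z) − c₂V(y)`; `#F = Σ_r #F_r` (a filtered product, summed over the first factor);
* `de_fibre_card_le_sqrt_coprime`: `#F_r ≤ √E_lin(q(r)) · √R_{q(r)}` (ratio Cauchy–Schwarz);
* `de_linRatioEnergy_le`: `E_lin(q) ≤ Dτ · 4Y₀Z₀ · (8Y₀Z₀/q + 3) ≤ Dτ · 4Y₀Z₀ · 11 max(1, Y₀Z₀/q₀)`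
  since `q₀ ≤ q(r)` (`de_onVal_corner_le`, `de_toolX_ratio_le`);
* Cauchy–Schwarz over the host tuples, `Σ_r √R_r ≤ √NQ · √(Σ_r R_r)` (`de_toolX_sum_sqrt_le`), and
  `de_energy_sum_le`: `Σ_r R_r ≤ 100 Dτ^{4d+7} (T₁ + T₂ + T₃ + T₄)`;

and the bookkeeping `de_toolX_assemble` (`44 · 100 = 4400`, `2d + 1 + (4d + 7) = 6d + 8`).
No new definitions; everything here is folklore bookkeeping.
-/

namespace Summit.ABC.ABC.Theorems.MazurKaneLaw

open Finset
open Literature.NumberTheory.DiophantineGeometry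
open Literature.NumberTheory.DiophantineGeometry.AbcShapes

/-- Cauchy–Schwarz against the constant function:
`Σ_{i ∈ s} √(g i) ≤ √#s · √(Σ_{i ∈ s} g i)` for nonnegative `g`. [folklore] -/
theorem de_toolX_sum_sqrt_le {ι : Type*} (s : Finset ι) (g : ι → ℝ) (hg : ∀ i, 0 ≤ g i) :
    ∑ i ∈ s, Real.sqrt (g i) ≤ Real.sqrt (s.card : ℝ) * Real.sqrt (∑ i ∈ s, g i) := by
  have h := Real.sum_sqrt_mul_sqrt_le s (f := fun _ => (1 : ℝ)) (fun _ => zero_le_one) hg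
  simpa only [Real.sqrt_one, one_mul, sum_const, nsmul_eq_mul, mul_one] using h

/-- The elementary step `8y/q + 3 ≤ 11 · max(1, y/q₀)` for `0 < q₀ ≤ q` and `0 ≤ y`. [folklore] -/
theorem de_toolX_ratio_le {y q q₀ : ℝ} (hy : 0 ≤ y) (hq₀ : 0 < q₀) (hle : q₀ ≤ q) :
    8 * y / q + 3 ≤ 11 * max 1 (y / q₀) := by
  have h1 : y / q ≤ y / q₀ := div_le_div_of_nonneg_left hy hq₀ hle
  have h2 : y / q₀ ≤ max 1 (y / q₀) := le_max_right _ _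
  have h3 : (1 : ℝ) ≤ max 1 (y / q₀) := le_max_left _ _
  rw [mul_div_assoc]
  linarith

/-- `2 W_{i₀} ≤ T` when `c V(2W) ≤ T` (`c ≥ 1`, positive `W`): the coordinate `i₀` of exponent
`1` enters `V(2W) = ∏ⱼ (2Wⱼ)^{j+1}` through the factor `2 W_{i₀}`, and all factors are positive.
[folklore] -/
theorem de_toolX_two_mul_le {d : ℕ} (i₀ : Fin d) (h0 : (i₀ : ℕ) = 0) {c : ℕ} (hc : 0 < c)
    (W : Fin d → ℕ) (hW : ∀ j, 0 < W j) {T : ℕ} (hT : c * shapeVal (fun j => 2 * W j) ≤ T) :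
    2 * W i₀ ≤ T := by
  have hpos : 0 < shapeVal (fun j => 2 * W j) := shapeVal_pos fun j => Nat.mul_pos two_pos (hW j)
  have hdvd : (2 * W i₀) ^ ((i₀ : ℕ) + 1) ∣ shapeVal (fun j => 2 * W j) :=
    dvd_prod_of_mem (fun i => (2 * W i) ^ ((i : ℕ) + 1)) (mem_univ i₀)
  calc 2 * W i₀ = (2 * W i₀) ^ ((i₀ : ℕ) + 1) := by rw [h0, zero_add, pow_one]
    _ ≤ shapeVal (fun j => 2 * W j) := Nat.le_of_dvd hpos hdvd
    _ ≤ c * shapeVal (fun j => 2 * W j) := Nat.le_mul_of_pos_left _ hc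
    _ ≤ T := hT

/-- **Bookkeeping of the DE tool.**  From `B ≤ D^d · F`, `F ≤ √(D · 4y · 11 max(1, m)) · (√NQ · √SR)`
and `SR ≤ 100 D^{4d+7} Tm` (everything nonnegative):
`B² ≤ 4400 · D^{6d+8} · y · max(1, m) · NQ · Tm`. [folklore] -/
theorem de_toolX_assemble {d : ℕ} {B Fc NQ SR Tm D y m : ℝ} (hB : B ≤ D ^ d * Fc)
    (hF : Fc ≤ Real.sqrt (D * (4 * y) * (11 * max 1 m)) * (Real.sqrt NQ * Real.sqrt SR))
    (hS : SR ≤ 100 * D ^ (4 * d + 7) * Tm) (hD : 0 ≤ D) (hy : 0 ≤ y) (hNQ : 0 ≤ NQ)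
    (hSR : 0 ≤ SR) (hB0 : 0 ≤ B) :
    B ^ 2 ≤ 4400 * D ^ (6 * d + 8) * y * max 1 m * NQ * Tm := by
  have hM : (0 : ℝ) ≤ max 1 m := le_trans zero_le_one (le_max_left _ _)
  have hE : 0 ≤ D * (4 * y) * (11 * max 1 m) := by positivity
  have hK : B ≤ D ^ d * (Real.sqrt (D * (4 * y) * (11 * max 1 m)) *
      (Real.sqrt NQ * Real.sqrt SR)) :=
    hB.trans (mul_le_mul_of_nonneg_left hF (pow_nonneg hD d))
  calc B ^ 2 ≤ (D ^ d * (Real.sqrt (D * (4 * y) * (11 * max 1 m)) *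
        (Real.sqrt NQ * Real.sqrt SR))) ^ 2 := pow_le_pow_left₀ hB0 hK 2
    _ = (D ^ d) ^ 2 * (D * (4 * y) * (11 * max 1 m)) * NQ * SR := by
        rw [mul_pow, mul_pow, mul_pow, Real.sq_sqrt hE, Real.sq_sqrt hNQ, Real.sq_sqrt hSR]
        ring
    _ ≤ (D ^ d) ^ 2 * (D * (4 * y) * (11 * max 1 m)) * NQ * (100 * D ^ (4 * d + 7) * Tm) :=
        mul_le_mul_of_nonneg_left hS (by positivity)
    _ = 4400 * D ^ (6 * d + 8) * y * max 1 m * NQ * Tm := by ring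

/-- **The DE tool with host `X`** (registered stub `de_dispersionToolX`, line
`critical-kloosterman-powerful-moduli` of crux stmt-ABC-2757).  For positive `cᵢ`, boxes with
positive corners `X, Y, Z`, `cᵢ V(2·) ≤ T`, `τ(m) ≤ Dτ` for `0 < m ≤ 8T³`, the linear coordinate
`i₀` and the quadratic one `i₁`, and any set `Q` of host coordinates (`q₀ = W_Q(X)`,
`NQ = #subBox Qᶜ X`):
`B² ≤ 4400 Dτ^{6d+8} · Y₀Z₀ · max(1, Y₀Z₀/q₀) · NQ · (T₁ + T₂ + T₃ + T₄)` with the four terms of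
`de_energy_sum_le`.  Proof: fibre over the host tuples `r` (`de_shapeCount_le_fibre`,
`#F = Σ_r #F_r`), ratio Cauchy–Schwarz on each modulus `q(r) = W_Q(r) ≥ q₀`
(`de_fibre_card_le_sqrt_coprime`) with the linear energy bound `de_linRatioEnergy_le`
(`8Y₀Z₀/q + 3 ≤ 11 max(1, Y₀Z₀/q₀)`), Cauchy–Schwarz over `r` (`de_toolX_sum_sqrt_le`), the energy
bound `de_energy_sum_le`, and `de_toolX_assemble`. [folklore] -/
theorem de_dispersionToolX : ∀ {d : ℕ} (i₀ i₁ : Fin d), (i₀ : ℕ) = 0 → (i₁ : ℕ) = 1 → ∀ {c₁ c₂ c₃ : ℕ}, 0 < c₁ → 0 < c₂ → 0 < c₃ → ∀ (X Y Z : Fin d → ℕ), (∀ j, 0 < X j) → (∀ j, 0 < Y j) → (∀ j, 0 < Z j) → ∀ {T Dτ : ℕ}, c₁ * shapeVal (fun j => 2 * X j) ≤ T → c₂ * shapeVal (fun j => 2 * Y j) ≤ T → c₃ * shapeVal (fun j => 2 * Z j) ≤ T → (∀ m : ℕ, m ≠ 0 → m ≤ 8 * T ^ 3 → m.divisors.card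 ≤ Dτ) → ∀ (Q : Finset (Fin d)), (shapeCount c₁ c₂ c₃ X Y Z : ℝ) ^ 2 ≤ 4400 * (Dτ : ℝ) ^ (6 * d + 8) * ((Y i₀ : ℝ) * Z i₀) * max 1 (((Y i₀ : ℝ) * Z i₀) / ((onVal Q X : ℕ) : ℝ)) * ((subBox Qᶜ X).card : ℝ) * (((subBox Qᶜ X).card : ℝ) * (((subBox ({i₀, i₁} : Finset (Fin d)) Y).card : ℝ) * ((subBox ({i₀, i₁} : Finset (Fin d)) Z).card : ℝ)) ^ 2 * (4 * ((Y i₁ : ℝ) * Z i₁)) ^ 2 / ((onVal Q X : ℕ) : ℝ) + ((subBox Qᶜ X).card : ℝ) * (((subBox ({i₀, i₁} : Finset (Fin d)) Y).card : ℝ) * ((subBox ({i₀, i₁} : Finset (Fin d)) Z).card : ℝ)) ^ 2 + (4 * ((Y i₁ : ℝ) * Z i₁)) * ((subBox Qᶜ X).card : ℝ) * (((subBox ({i₀, i₁} : Finset (Fin d)) Y).card : ℝ) * ((subBox ({i₀, i₁} : Finset (Fin d)) Z).card : ℝ)) + (4 * ((Y i₁ : ℝ) * Z i₁)) * (((subBox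 ({i₀, i₁} : Finset (Fin d)) Y).card : ℝ) * ((subBox ({i₀, i₁} : Finset (Fin d)) Z).card : ℝ)) ^ 2 * Real.sqrt ((subBox Qᶜ X).card : ℝ)) := by
  intro d i₀ i₁ h0 h1 c₁ c₂ c₃ hc₁ hc₂ hc₃ X Y Z hX hY hZ T Dτ hTX hTY hTZ hD Q
  -- `T ≥ 1`, the weak divisor hypothesis, `V(2X) ≤ T`
  have hT0 : 0 < T :=
    lt_of_lt_of_le (Nat.mul_pos hc₁ (shapeVal_pos fun j => Nat.mul_pos two_pos (hX j))) hTX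
  have hT3 : T ≤ 8 * T ^ 3 :=
    (Nat.le_self_pow (by norm_num) T).trans (Nat.le_mul_of_pos_left _ (by norm_num))
  have hD' : ∀ m : ℕ, m ≠ 0 → m ≤ T → m.divisors.card ≤ Dτ := fun m hm hmT =>
    hD m hm (hmT.trans hT3)
  have hTX' : shapeVal (fun j => 2 * X j) ≤ T := (Nat.le_mul_of_pos_left _ hc₁).trans hTX
  -- the divisor hypothesis of the linear energy bound: `4Y₀Z₀ = (2Y₀)(2Z₀) ≤ T² ≤ 8T³`
  have h4YZ : 4 * (Y i₀ * Z i₀) ≤ 8 * T ^ 3 :=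
    calc 4 * (Y i₀ * Z i₀) = (2 * Y i₀) * (2 * Z i₀) := by ring
      _ ≤ T * T := Nat.mul_le_mul (de_toolX_two_mul_le i₀ h0 hc₂ Y hY hTY)
          (de_toolX_two_mul_le i₀ h0 hc₃ Z hZ hTZ)
      _ = T ^ 2 := (sq T).symm
      _ ≤ T ^ 3 := Nat.pow_le_pow_right hT0 (by norm_num)
      _ ≤ 8 * T ^ 3 := Nat.le_mul_of_pos_left _ (by norm_num)
  have hDlin : ∀ m : ℕ, m ≠ 0 → m ≤ 4 * (Y i₀ * Z i₀) → m.divisors.card ≤ Dτ :=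
    fun m hm hle => hD m hm (hle.trans h4YZ)
  -- the host moduli `q(r) = W_Q(r) ≥ q₀ = W_Q(X) > 0`
  have hq : ∀ r ∈ subBox Qᶜ X, 0 < onVal Q r := fun r hr =>
    Nat.pos_of_ne_zero (de_onVal_ne_zero_and_le hX hr).1
  have hq₀ : (0 : ℝ) < ((onVal Q X : ℕ) : ℝ) :=
    Nat.cast_pos.mpr (prod_pos fun i _ => pow_pos (hX i) _)
  have hy0 : (0 : ℝ) ≤ (Y i₀ : ℝ) * Z i₀ := by positivity
  -- per host tuple: ratio Cauchy–Schwarz and the linear energy bound, `#F_r ≤ √Ebar · √R_r`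
  have hFr : ∀ r ∈ subBox Qᶜ X,
      ((((dyadicBox Y ×ˢ dyadicBox Z).filter (fun t : (Fin d → ℕ) × (Fin d → ℕ) =>
        Nat.Coprime (onVal Q r) (c₂ * shapeVal t.1) ∧ Nat.Coprime (onVal Q r) (c₃ * shapeVal t.2) ∧
          ((onVal Q r : ℕ) : ℤ) ∣ ((c₃ * shapeVal t.2 : ℕ) : ℤ) - ((c₂ * shapeVal t.1 : ℕ) : ℤ))).card
            : ℕ) : ℝ) ≤
        Real.sqrt ((Dτ : ℝ) * (4 * ((Y i₀ : ℝ) * Z i₀)) *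
            (11 * max 1 (((Y i₀ : ℝ) * Z i₀) / ((onVal Q X : ℕ) : ℝ)))) *
          Real.sqrt ((((subBox {i₀} Y ×ˢ subBox {i₀} Z) ×ˢ (subBox {i₀} Y ×ˢ subBox {i₀} Z)).filter
            (fun p : ((Fin d → ℕ) × (Fin d → ℕ)) × ((Fin d → ℕ) × (Fin d → ℕ)) =>
              Nat.Coprime (onVal Q r) (c₂ * offVal {i₀} p.1.1) ∧
              Nat.Coprime (onVal Q r) (c₃ * offVal {i₀} p.1.2) ∧
              Nat.Coprime (onVal Q r) (c₂ * offVal {i₀} p.2.1) ∧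
              Nat.Coprime (onVal Q r) (c₃ * offVal {i₀} p.2.2) ∧
              ((onVal Q r) : ℤ) ∣ ((c₂ * offVal {i₀} p.2.1 * (c₃ * offVal {i₀} p.1.2) : ℕ) : ℤ) -
                ((c₂ * offVal {i₀} p.1.1 * (c₃ * offVal {i₀} p.2.2) : ℕ) : ℤ))).card : ℝ) := by
    intro r hr
    refine (de_fibre_card_le_sqrt_coprime i₀ h0 (onVal Q r) c₂ c₃ (hq r hr) hc₂ hc₃ Y Z hY
      hZ).trans (mul_le_mul_of_nonneg_right (Real.sqrt_le_sqrt ?_) (Real.sqrt_nonneg _))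
    exact (de_linRatioEnergy_le (onVal Q r) (Y i₀) (Z i₀) Dτ (hq r hr) hDlin).trans
      (mul_le_mul_of_nonneg_left
        (de_toolX_ratio_le hy0 hq₀ (Nat.cast_le.mpr (de_onVal_corner_le hr))) (by positivity))
  -- assembly: fibring, the sum over the host tuples, Cauchy–Schwarz and the energy bound
  refine de_toolX_assemble (de_shapeCount_le_fibre hc₁ hc₂ hc₃ X Y Z hX hY hZ hTX hD' Q) ?_
    (de_energy_sum_le i₀ i₁ h0 h1 hc₂ hc₃ X Y Z hX hY hZ hTX' hTY hTZ hD Q) (Nat.cast_nonneg _)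
    hy0 (Nat.cast_nonneg _) (sum_nonneg fun _ _ => Nat.cast_nonneg _) (Nat.cast_nonneg _)
  -- `#F = Σ_r #F_r`: the cardinality of a filtered product is a sum over the first factor
  have hcf : ∀ (s : Finset (Fin d → ℕ)) (t : Finset ((Fin d → ℕ) × (Fin d → ℕ)))
      (P : (Fin d → ℕ) × ((Fin d → ℕ) × (Fin d → ℕ)) → Prop) [DecidablePred P],
      ((s ×ˢ t).filter P).card = ∑ a ∈ s, (t.filter (fun b => P (a, b))).card := by
    intro s t P _
    rw [card_filter, sum_product]
    exact sum_congr rfl fun a _ => (card_filter _ _).symm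
  rw [hcf, Nat.cast_sum]
  refine (sum_le_sum hFr).trans ?_
  rw [← mul_sum]
  exact mul_le_mul_of_nonneg_left (de_toolX_sum_sqrt_le _ _ fun _ => Nat.cast_nonneg _)
    (Real.sqrt_nonneg _)

end Summit.ABC.ABC.Theorems.MazurKaneLaw
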